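import Mathlib.Analysis.Normed.Group.Basic
import Mathlib.Topology.MetricSpace.ProperSpace
import Mathlib.Topology.MetricSpace.Pseudo.Lemmas
import Mathlib.Data.Fintype.Pi
import Mathlib.Data.Fintype.Option
import HarnessLib

/-!
# Finite sup-norm nets for uniformly small-tailed, equicontinuous, bounded families
  (Arzelà–Ascoli on a proper space modulo tails)

Analysis/FunctionSpaces support file (everything proved; no definitions, no named facts).  The
classical compactness criterion in `C₀`: a family `𝒮` of functions `X → F` on a proper metric
space `X` with values in a proper normed group `F` which is

* uniformly bounded (`‖f x‖ ≤ B`),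
* uniformly small at infinity (`∀ ε > 0, ∃ A, ∀ f ∈ 𝒮, A ≤ dist x x₀ → ‖f x‖ ≤ ε`), and
* uniformly equicontinuous (`∀ ε > 0, ∃ δ > 0, ∀ f ∈ 𝒮, dist x y < δ → ‖f x − f y‖ ≤ ε`),

is **totally bounded in the sup norm**: for every `ε > 0` finitely many members of `𝒮` are
`ε`-dense in `𝒮` uniformly on `X` (`exists_finite_sup_net`).  This is the form of the
Arzelà–Ascoli theorem (Rudin, *Principles*, Thm. 7.25; Mathlib's
`BoundedContinuousFunction.arzela_ascoli` is the compact-domain statement) by which integral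
operators with decaying, regularising kernels are shown to be COMPACT on spaces of continuous
functions vanishing at infinity (e.g. the Duhamel part of the linearised Navier–Stokes period map
around a Type-I profile).  The proof is the direct finite-coding argument: a finite `δ`-net of
points of the ball `B̄(x₀, A)`, a finite `ε`-net of values of `B̄(0, B) ⊆ F`, and one
representative of `𝒮` per realised code `net of points → net of values`; no compactness of a
function space is invoked.

## Mathlib search

`finite_cover_balls_of_compact`, `isCompact_closedBall` (proper spaces), `Fintype` of function
types between finite types (`Pi.fintype`, `instFintypeOption`), `Set.finite_range`.

## References

* W. Rudin, *Principles of Mathematical Analysis*, 3rd ed., Thm. 7.25 (Arzelà–Ascoli). [folklore]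
-/

open Set Metric Function

namespace Literature.Analysis.FunctionSpaces

variable {X : Type*} [PseudoMetricSpace X] [ProperSpace X]
variable {F : Type*} [NormedAddCommGroup F] [ProperSpace F]

/-- **Finite sup-norm nets (Arzelà–Ascoli modulo tails).**  Let `𝒮` be a family of functions
`X → F` (`X` a proper pseudo-metric space, `F` a proper normed group) which is uniformly bounded
by `B`, uniformly small outside large balls around `x₀`, and uniformly equicontinuous.  Then for
every `ε > 0` there is a finite `t ⊆ 𝒮` such that every `f ∈ 𝒮` is within `ε` of some `g ∈ t`
uniformly on `X`.  Proof: with `ε' = ε/4`, take the tail radius `A` for `ε'`, the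
equicontinuity radius `δ` for `ε'`, a finite `δ`-net `P` of `B̄(x₀, A)` and a finite `ε'`-net `Q`
of `B̄(0, B)`; code each `f` by a map `P → Q` with `‖f p − code p‖ < ε'`, keep one member of `𝒮`
per realised code; two functions with the same code differ by `≤ 4ε'` on `B̄(x₀, A)` and by
`≤ 2ε'` off it. (Rudin, Thm. 7.25.) [folklore] -/
theorem exists_finite_sup_net (x₀ : X) {B : ℝ} (𝒮 : Set (X → F))
    (hbd : ∀ f ∈ 𝒮, ∀ x, ‖f x‖ ≤ B)
    (htail : ∀ ε : ℝ, 0 < ε → ∃ A : ℝ, ∀ f ∈ 𝒮, ∀ x, A ≤ dist x x₀ → ‖f x‖ ≤ ε)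
    (hequi : ∀ ε : ℝ, 0 < ε → ∃ δ : ℝ, 0 < δ ∧ ∀ f ∈ 𝒮, ∀ x y, dist x y < δ → ‖f x - f y‖ ≤ ε)
    {ε : ℝ} (hε : 0 < ε) :
    ∃ t ⊆ 𝒮, t.Finite ∧ ∀ f ∈ 𝒮, ∃ g ∈ t, ∀ x, ‖f x - g x‖ ≤ ε := by
  classical
  set ε' : ℝ := ε / 4 with hε'
  have hε'0 : 0 < ε' := by positivity
  obtain ⟨A, hA⟩ := htail ε' hε'0
  obtain ⟨δ, hδ, hδf⟩ := hequi ε' hε'0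
  -- finite `δ`-net of points of the ball `B̄(x₀, A)`
  obtain ⟨P, -, hPfin, hPcov⟩ :=
    finite_cover_balls_of_compact (isCompact_closedBall x₀ A) hδ
  -- finite `ε'`-net of values of `B̄(0, B)`
  obtain ⟨Q, -, hQfin, hQcov⟩ :=
    finite_cover_balls_of_compact (isCompact_closedBall (0 : F) B) hε'0
  haveI : Fintype P := hPfin.fintype
  haveI : Fintype Q := hQfin.fintype
  -- every value `f p` (`f ∈ 𝒮`) is `ε'`-close to some `q ∈ Q`
  have hval : ∀ f ∈ 𝒮, ∀ p : X, ∃ q ∈ Q, ‖f p - q‖ < ε' := by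
    intro f hf p
    have hmem : f p ∈ closedBall (0 : F) B := by
      simpa only [mem_closedBall, dist_zero_right] using hbd f hf p
    obtain ⟨q, hq, hpq⟩ := mem_iUnion₂.1 (hQcov hmem)
    exact ⟨q, hq, by simpa [dist_eq_norm] using hpq⟩
  -- the code of a function: a map `P → Option Q` (`none` only off `𝒮`)
  let code : (X → F) → (P → Option Q) := fun f p =>
    if h : ∃ q ∈ Q, ‖f p - q‖ < ε' then some ⟨h.choose, h.choose_spec.1⟩ else none
  have hcode : ∀ f ∈ 𝒮, ∀ p : P, ∃ q : Q, code f p = some q ∧ ‖f p - (q : F)‖ < ε' := by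
    intro f hf p
    have h : ∃ q ∈ Q, ‖f (p : X) - q‖ < ε' := hval f hf p
    exact ⟨⟨h.choose, h.choose_spec.1⟩, by simp only [code, dif_pos h], h.choose_spec.2⟩
  -- two members of `𝒮` with the same code are uniformly `ε`-close
  have hclose : ∀ f ∈ 𝒮, ∀ g ∈ 𝒮, code f = code g → ∀ x, ‖f x - g x‖ ≤ ε := by
    intro f hf g hg hfg x
    by_cases hx : dist x x₀ ≤ A
    · -- inside the ball: through a net point and the common code value
      obtain ⟨p, hp, hxp⟩ := mem_iUnion₂.1 (hPcov (mem_closedBall.2 hx))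
      obtain ⟨qf, hqf, hfq⟩ := hcode f hf ⟨p, hp⟩
      obtain ⟨qg, hqg, hgq⟩ := hcode g hg ⟨p, hp⟩
      have hq : qf = qg := by
        have := congrFun hfg ⟨p, hp⟩
        rw [hqf, hqg, Option.some.injEq] at this
        exact this
      subst hq
      have h1 : ‖f x - f p‖ ≤ ε' := hδf f hf x p (by rwa [mem_ball] at hxp)
      have h2 : ‖g x - g p‖ ≤ ε' := hδf g hg x p (by rwa [mem_ball] at hxp)
      calc ‖f x - g x‖ = ‖(f x - f p) + (f p - (qf : F)) - (g p - (qf : F)) - (g x - g p)‖ := by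
            congr 1; abel
        _ ≤ ‖f x - f p‖ + ‖f p - (qf : F)‖ + ‖g p - (qf : F)‖ + ‖g x - g p‖ := by
            refine (norm_sub_le _ _).trans ?_
            gcongr
            refine (norm_sub_le _ _).trans ?_
            gcongr
            exact norm_add_le _ _
        _ ≤ ε' + ε' + ε' + ε' := by gcongr
        _ = ε := by rw [hε']; ring
    · -- outside the ball: both are small
      have hxA : A ≤ dist x x₀ := (not_le.1 hx).le
      calc ‖f x - g x‖ ≤ ‖f x‖ + ‖g x‖ := norm_sub_le _ _
        _ ≤ ε' + ε' := add_le_add (hA f hf x hxA) (hA g hg x hxA)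
        _ ≤ ε := by rw [hε']; linarith
  -- one representative of `𝒮` per realised code
  let K : Type _ := {κ : P → Option Q // ∃ f ∈ 𝒮, code f = κ}
  haveI : Finite K := Subtype.finite
  let rep : K → (X → F) := fun κ => κ.2.choose
  have hrep : ∀ κ : K, rep κ ∈ 𝒮 ∧ code (rep κ) = κ.1 := fun κ => κ.2.choose_spec
  refine ⟨range rep, ?_, finite_range rep, fun f hf => ?_⟩
  · rintro _ ⟨κ, rfl⟩
    exact (hrep κ).1
  · refine ⟨rep ⟨code f, f, hf, rfl⟩, mem_range_self _, ?_⟩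
    exact hclose f hf _ (hrep _).1 ((hrep ⟨code f, f, hf, rfl⟩).2.symm)

end Literature.Analysis.FunctionSpaces
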